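import Literature.NumberTheory.LFunctions.Zhang2022.KnifeEdgeEllVernierEdgeCells
import Literature.NumberTheory.LFunctions.Zhang2022.DetectorDoublingCompose

/-!
# §D edge ell — the vernier typed layer AFTER E-102 head 2: every SIGN-ADMISSIBLE vernier cell is PSD (kernel), so the
# OPEN shapes `VernierThetaBlindPSD`, `VernierGridPSD`, `VernierScaledPSD`, `VernierDetectorCellPSD`, `VernierExactCellPSD`
# are THEOREMS on their non-straddling cells, and `VernierGridDichotomy`'s positive side holds for every cell

Y. Zhang, *Discrete mean estimates and the Landau–Siegel zero*, arXiv:2211.02515v1 [Zhang2022LandauSiegel] — an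
unrefereed manuscript under adjudication. **WHAT THIS IS NOT: not a claim about Theorems 1–2 of arXiv:2211.02515, about
Landau–Siegel zeros, about Parity, or about a repaired `Margin232`. The card `ell-vernier-far-pair` is CLOSED (falsified);
what is proved here is positivity of booked main-term forms — the OPPOSITE of a sign crux — on the sign-admissible cells, as
a corollary of the cell's E-102 head-2 theorem. The programme SEARCHES and TYPES; no claim about Landau–Siegel zeros,
Theorems 1–2 of arXiv:2211.02515 or a repaired Margin232 until a kernel theorem says so.** (LANDAU–SIEGEL programme F-S3,
cell `landau-siegel`, §D edge ell; typer ls-knife-typer-2 g4; antecedent `Det.formDetPSD_shiftRecipe_of_signAdmissible`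
(`DetectorDoublingCompose`, ls-Bdet-typer-2 g2 et al., p490608, 2026-08-27T03:5xZ: `Det.SignAdmissible b →
Det.FormDetPSD (Det.shiftRecipe b)` — Lemma 2.3's sign box ⇒ PSD, for EVERY triple).)

## What is here (theorems only)

* `vernierThetaBlindPSD_of_admissible` — the θ-blind control `VernierThetaBlindPSD b₀ J m` (p475215, formerly OPEN with the
  printed instance `_printed` only) HOLDS for every `0 < b₀ ≤ 1`, `J ≥ 1`, `0 < m < ½`.
* `vernierGridPSD_of_signAdmissible` / `vernierGridPSD_of_nonstraddling` — the grid-unit slot `VernierGridPSD b₀ J m θ`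
  (p483608) HOLDS whenever the offset far pair does not straddle (`θ ≤ m ∨ 1 − m ≤ θ`; `0 < b₀ ≤ 1`, `0 < m < ½`,
  `0 ≤ θ < 1`, `J ≥ 2`); hence **`vernierGridDichotomy_pos` — the positive direction of `VernierGridDichotomy J m` for
  EVERY cell** (the negative direction is kernel at `θ = ½`, `not_vernierGridPSD_half`, p490724; open elsewhere), and
  `vernierGridDichotomy_at_half` (both directions at `θ = ½`).
* `vernierScaledPSD_of_signAdmissible` / `vernierScaledPSD_of_gap` — the consistent-booking slot `VernierScaledPSD c J m`
  (p484053) HOLDS at every scaling `0 < c ≤ 1` whose scaled far pair `(c(J+m), c(J+1−m))` lies in one integer gap; so the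
  barrier-note shape `ConsistentVernierPSD J m` REDUCES to its straddling scalings (`consistentVernierPSD_of_straddlers`;
  those remain certified numerically only — kit j264045 etc.).
* `vernierDetectorCellPSD_of_nonstraddling` — the typed detector's own K1 slot (p484678) HOLDS at every non-straddling cell
  with `0 ≤ κ(c′,θ) < J`; `vernierExactCellPSD_of_gap` — the referee's exact-conversion cells (p484942) in one gap HOLD.

References: Zhang, arXiv:2211.02515v1, §2 (2.13), Lemma 2.3 p.6; Prop 7.1 p.44 (7.2)
[cite: Zhang2022LandauSiegel, §2 Lemma 2.3; Prop 7.1 p.44].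
-/

noncomputable section

open Complex Real

namespace Literature.NumberTheory.LFunctions.Zhang2022.KnifeEdgeEll.Vernier

open Literature.NumberTheory.LFunctions.Zhang2022

/-! ## The θ-blind control and the grid-unit slot -/

/-- **The θ-blind control slot HOLDS for every admissible vernier triple** (`0 < b₀ ≤ 1`, `J ≥ 1`, `0 < m < ½`): the
triple is in Lemma 2.3's sign box (`vernier_signAdmissible`, FL0a) and E-102 head 2 gives PSD.
[cite: Zhang2022LandauSiegel, §2 Lemma 2.3, (2.13); Prop 7.1 p.44] -/
theorem vernierThetaBlindPSD_of_admissible {b₀ m : ℝ} {J : ℕ} (hb₀ : 0 < b₀) (hb₀' : b₀ ≤ 1) (hJ : 1 ≤ J)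
    (hm : 0 < m) (hm' : m < 1 / 2) : VernierThetaBlindPSD b₀ J m := by
  unfold VernierThetaBlindPSD vernierRecipe
  exact Det.formDetPSD_shiftRecipe_of_signAdmissible (vernier_signAdmissible hb₀ hb₀' hJ hm hm')

/-- **The grid-unit slot HOLDS on every sign-admissible offset triple.** [cite: Zhang2022LandauSiegel, §2 Lemma 2.3; Prop 7.1 p.44] -/
theorem vernierGridPSD_of_signAdmissible {b₀ m θ : ℝ} {J : ℕ} (h : Det.SignAdmissible (vernierShiftsOff b₀ J m θ)) :
    VernierGridPSD b₀ J m θ := by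
  unfold VernierGridPSD vernierGridRecipe
  exact Det.formDetPSD_shiftRecipe_of_signAdmissible h

/-- **The grid-unit slot HOLDS whenever the offset far pair does not straddle** (`θ ≤ m ∨ 1 − m ≤ θ`).
[cite: Zhang2022LandauSiegel, §2 Lemma 2.3, (2.13); Prop 7.1 p.44] -/
theorem vernierGridPSD_of_nonstraddling {b₀ m θ : ℝ} {J : ℕ} (hb₀ : 0 < b₀) (hb₀' : b₀ ≤ 1) (hm : 0 < m)
    (hm' : m < 1 / 2) (hθ : 0 ≤ θ) (hθ' : θ < 1) (hJ : 2 ≤ J) (h : θ ≤ m ∨ 1 - m ≤ θ) :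
    VernierGridPSD b₀ J m θ :=
  vernierGridPSD_of_signAdmissible ((signAdmissible_vernierShiftsOff_iff hb₀ hb₀' hm hm' hθ hθ' hJ).mpr h)

/-- **The positive direction of `VernierGridDichotomy J m` holds for EVERY cell** (`0 < m < ½`, `J ≥ 2`): non-straddling
⇒ PSD. (The negative direction — straddling ⇒ ¬PSD — is kernel at `θ = ½`, `not_vernierGridPSD_half`, and open for the other
straddling offsets.) [cite: Zhang2022LandauSiegel, §2 Lemma 2.3; Prop 7.1 p.44] -/
theorem vernierGridDichotomy_pos {J : ℕ} {m : ℝ} (hm : 0 < m) (hm' : m < 1 / 2) (hJ : 2 ≤ J) {θ : ℝ} (hθ : 0 ≤ θ)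
    (hθ' : θ < 1) (h : θ ≤ m ∨ 1 - m ≤ θ) : VernierGridPSD 1 J m θ :=
  vernierGridPSD_of_nonstraddling one_pos le_rfl hm hm' hθ hθ' hJ h

/-- **`VernierGridDichotomy` at the maximal straddle, both directions (kernel):** at `θ = ½` the slot is PSD iff the cell does
not straddle — i.e. never, for `0 < m < ½` (`not_vernierGridPSD_half`). [cite: Zhang2022LandauSiegel, §2 Lemma 2.3; Prop 7.1 p.44] -/
theorem vernierGridDichotomy_at_half {J : ℕ} {m : ℝ} (hm : 0 < m) (hm' : m < 1 / 2) (hJ : 2 ≤ J) :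
    VernierGridPSD 1 J m (1 / 2) ↔ ((1 : ℝ) / 2 ≤ m ∨ 1 - m ≤ 1 / 2) :=
  vernierGridPSD_half_iff hJ hm hm'

/-! ## The consistent-booking slot and the barrier-note shape -/

/-- **The consistent-booking slot HOLDS on every sign-admissible scaled triple.** [cite: Zhang2022LandauSiegel, §2 Lemma 2.3; Prop 7.1 p.44] -/
theorem vernierScaledPSD_of_signAdmissible {c m : ℝ} {J : ℕ} (h : Det.SignAdmissible (vernierScaledShifts c J m)) :
    VernierScaledPSD c J m := by
  unfold VernierScaledPSD vernierScaledRecipe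
  exact Det.formDetPSD_shiftRecipe_of_signAdmissible h

/-- **… in particular at every scaling whose far pair stays in one integer gap**: `0 < c ≤ 1`, `J ≥ 1`, `0 < m < ½`, and
`k ≤ c(J+m)`, `c(J+1−m) ≤ k+1` for some `k ∈ ℕ`. [cite: Zhang2022LandauSiegel, §2 Lemma 2.3, (2.13); Prop 7.1 p.44] -/
theorem vernierScaledPSD_of_gap {c m : ℝ} {J : ℕ} (hc : 0 < c) (hc1 : c ≤ 1) (hJ : 1 ≤ J) (hm : 0 < m)
    (hm' : m < 1 / 2) (k : ℕ) (hk : (k : ℝ) ≤ c * ((J : ℝ) + m)) (hk' : c * ((J : ℝ) + 1 - m) ≤ k + 1) :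
    VernierScaledPSD c J m := by
  refine vernierScaledPSD_of_signAdmissible ⟨?_, ?_, ?_, ?_, k, ?_, ?_⟩ <;>
    simp only [vernierScaledShifts, vernierShifts, Matrix.cons_val_zero, Matrix.cons_val_one, Matrix.cons_val_two,
      Matrix.head_cons, Matrix.tail_cons]
  · linarith
  · have hJr : (1 : ℝ) ≤ (J : ℝ) := by exact_mod_cast hJ
    nlinarith
  · nlinarith
  · linarith
  · exact hk
  · exact hk'

/-- **The barrier-note shape reduces to its straddling scalings:** `ConsistentVernierPSD J m` (p484053) holds as soon as the
slot is PSD at every scaling `c ∈ (0,1]` whose far pair STRADDLES an integer (no `k` with `k ≤ c(J+m)`, `c(J+1−m) ≤ k+1`) —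
the non-straddling scalings are covered by `vernierScaledPSD_of_gap`. (`J ≥ 1`, `0 < m < ½`.)
[cite: Zhang2022LandauSiegel, §2 Lemma 2.3; Prop 7.1 p.44] -/
theorem consistentVernierPSD_of_straddlers {J : ℕ} {m : ℝ} (hJ : 1 ≤ J) (hm : 0 < m) (hm' : m < 1 / 2)
    (h : ∀ c : ℝ, 0 < c → c ≤ 1 → (∀ k : ℕ, ¬ ((k : ℝ) ≤ c * ((J : ℝ) + m) ∧ c * ((J : ℝ) + 1 - m) ≤ k + 1)) →
      VernierScaledPSD c J m) : ConsistentVernierPSD J m := by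
  intro c hc hc1
  by_cases hs : ∃ k : ℕ, (k : ℝ) ≤ c * ((J : ℝ) + m) ∧ c * ((J : ℝ) + 1 - m) ≤ k + 1
  · obtain ⟨k, hk, hk'⟩ := hs
    exact vernierScaledPSD_of_gap hc hc1 hJ hm hm' k hk hk'
  · push Not at hs
    exact h c hc hc1 fun k hk => (hs k hk.1).not_ge hk.2

/-! ## The typed detector's own slot and the referee's exact-conversion cells -/

/-- **The typed detector's K1 slot HOLDS at every non-straddling cell** with near coordinate `0 < 1 − κ/J ≤ 1`, i.e.
`0 ≤ κ(c′, θ) < J` (`κ = 10πc′θ`): `VernierDetectorCellPSD c′ J m θ` (p484678) for `θ ≤ m ∨ 1 − m ≤ θ`.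
[cite: Zhang2022LandauSiegel, §2 Lemma 2.3, (2.13); Prop 7.1 p.44] -/
theorem vernierDetectorCellPSD_of_nonstraddling {c' m θ : ℝ} {J : ℕ} (hκ0 : 0 ≤ kappaNear c' θ)
    (hκ : kappaNear c' θ < J) (hm : 0 < m) (hm' : m < 1 / 2) (hθ : 0 ≤ θ) (hθ' : θ < 1) (hJ : 2 ≤ J)
    (h : θ ≤ m ∨ 1 - m ≤ θ) : VernierDetectorCellPSD c' J m θ := by
  unfold VernierDetectorCellPSD
  have hJ0 : (0 : ℝ) < (J : ℝ) := by exact_mod_cast (show 0 < J by omega)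
  refine vernierGridPSD_of_nonstraddling ?_ ?_ hm hm' hθ hθ' hJ h
  · rw [sub_pos, div_lt_one hJ0]; exact hκ
  · rw [sub_le_self_iff]; exact div_nonneg hκ0 hJ0.le

/-- **The referee's exact-conversion cell HOLDS when its scaled far pair lies in one gap** (`0 ≤ θ < J + ½`, `J ≥ 1`,
`0 < m < ½`, gap witness `k`). [cite: Zhang2022LandauSiegel, §2 Lemma 2.3, (2.13); Prop 7.1 p.44] -/
theorem vernierExactCellPSD_of_gap {θ m : ℝ} {J : ℕ} (hθ : 0 ≤ θ) (hθJ : θ < (J : ℝ) + 1 / 2) (hJ : 1 ≤ J)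
    (hm : 0 < m) (hm' : m < 1 / 2) (k : ℕ) (hk : (k : ℝ) ≤ exactConversionScale θ J * ((J : ℝ) + m))
    (hk' : exactConversionScale θ J * ((J : ℝ) + 1 - m) ≤ k + 1) : VernierExactCellPSD θ J m := by
  have hJ' : (0 : ℝ) < (J : ℝ) + 1 / 2 := by positivity
  refine vernierScaledPSD_of_gap ?_ ?_ hJ hm hm' k hk hk'
  · rw [exactConversionScale, sub_pos, div_lt_one hJ']; exact hθJ
  · rw [exactConversionScale, sub_le_self_iff]; exact div_nonneg hθ hJ'.le

end Literature.NumberTheory.LFunctions.Zhang2022.KnifeEdgeEll.Vernier
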